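import Literature.AlgebraicGeometry.Motives.HodgeThetaSubalgebraUnitaryNineTenCore
import HarnessLib

/-!
# Raising-space dimension bounds, general form: type `(r | kr)` of constant raising rank `r` has at most `k`
# independent raising operators; irreducible type `(kr | b)`, `b ∉ {0, r}`, with raising ranks in `{0, r}` has more
# than `k`; transfer of a spanning family through a Levi pair (Ribet 1983 Thm. 3, Lie step)

Family `hodge`, layer `Literature/AlgebraicGeometry/Motives` (pure linear algebra over `ℂ`; no geometry). Research
context: cell `pub-hodge-ring2` (HONEST FRAMING: research route conditional on HC_CM; not a corollary; Q11.4-sentence-2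
already refuted in dim ≥ 3), Literature lane gen 87, programme R75 «raising-space dimension». UNCONDITIONAL; theorems
only, no definition, no named fact (D-0026), no `sorry`. This file generalises `HodgeThetaSubalgebraUnitaryRaisingSpaceDimension`
(the case `k = 2`, which closed the `(9 | 10)` cell) to every `k`; the case `k = 4` enters the `(15 | 16)` cell at a
maximal raising rank `12` (Levi types `(3 | 12)` and `(12 | 4)`).

THE SETTING is that of the tree's unitary cores: `𝔊 ⊆ End_ℂ(W)` bracket-closed and irreducible, an involution
`Θ ∈ 𝔊` with eigenspaces `P`, `Q`, a Hermitian pairing `s` with `P ⊥ Q`, definite on `P` and on `Q`, for which `𝔊`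
is adjoint-closed; raising operators `X` (`ΘX = X = −XΘ`) map `Q → P` and kill `P`.

* §1 **`UnitaryConstantRank.exists_fin_span_raise`** — type `(r | kr)`, every non-zero raising operator of rank
  `r = dim P`: the raising operators lie in the span of `k` of them. Induction on `k` through the Levi algebra `L⁻`
  of a non-zero raising `X` (type `(r | (k − 1)r)`, again of constant raising rank `r`): with the involution `ι` of
  `X` (`U⁻ = P ⊕ (Q ∩ ker X) ⊇ P`, `U⁺ = Q ∩ U⁺` of dimension `r`), every raising `Y` splits INSIDE `𝔊` as
  `½(Y − ιYι) + ½(Y + ιYι)` (`ιYι = Y − ½[ι, [ι, Y]]`); the first summand kills `U⁻` and takes its values on `U⁺`,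
  where `X` is injective, so it is a multiple of `X` (`UnitaryRaisingSpace.exists_finrank_range_sub_smul_lt` and the
  constant rank); the second commutes with `ι`, restricts to a raising element of `L⁻`, hence is a combination of the
  lifts of a spanning family of `L⁻` (two raising operators commuting with `ι` that agree on `U⁻` agree: their
  difference maps `U⁺` into `P ∩ U⁺ = 0`).
* §2 **`UnitaryConstantRank.exists_raise_not_mem_span_fin`** — irreducible, raising ranks in `{0, r}`, `dim P = kr`,
  `0 < dim Q ≠ r`: no `k` raising operators span the raising space (their images would cover `P`,
  `UnitaryThetaCore.mem_span_raise_apply`, hence be independent of dimension `r` each, §2's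
  `UnitaryRaisingSpace.sum_eq_zero_of_finrank_iSup`; the joint kernel on `Q` of all raising operators is zero,
  `UnitaryThetaCore.eq_zero_of_forall_raise_apply_eq_zero`, so their sum is injective on `Q`, of rank `dim Q ∉ {0, r}`).
* §3 **`UnitaryLeviSetup.exists_fin_span_transfer`** — at a raising `B` with Levi pair `L⁺`, `L⁻`: if every raising
  operator commuting with `ι` that vanishes on `U⁺` vanishes on `U⁻`, a spanning family of `k` raising elements of
  `L⁺` yields one of `L⁻` (lift, restrict).

## References
* [Ribet1983] K. A. Ribet, *Hodge classes on certain types of abelian varieties*, Amer. J. Math. 105 (1983), Thm. 3.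
* [Gordon1997] B. B. Gordon, *A survey of the Hodge conjecture for abelian varieties*, Thm. 6.3 (3), pp. 18–19.
* [Deligne1982HodgeCycles] P. Deligne, *Hodge cycles on abelian varieties*, LNM 900 (1982), I §3 Prop. 3.4, 3.6.
* [GoodmanWallachGTM255] R. Goodman, N. R. Wallach, GTM 255 (2009), §4.1.1 (gradings, centralisers of involutions).
* [HoffmanKunze1971LinearAlgebra] K. Hoffman, R. Kunze, *Linear Algebra* (1971), §3.1 Thm. 2 (rank–nullity), §6.7
  (projections, direct sums), §8.3.
-/

noncomputable section

open Module

namespace Literature.AlgebraicGeometry.Motives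

namespace HodgeStructure

universe u

variable {W : Type u} [AddCommGroup W] [Module ℂ W]

/-! ### §1 Type `(r | kr)` of constant raising rank `r`: at most `k` independent raising operators -/

/-- **Type `(r | kr)` with constant raising rank `r = dim P`: the raising operators lie in the span of `k` of them.**
(Irreducible unitary setting; induction on `k` through the Levi algebra `L⁻` of a non-zero raising operator, see the
module docstring.) [cite: GoodmanWallachGTM255, §4.1.1] [cite: Gordon1997, §6 (proof of Thm. 6.3.3)]
[cite: Deligne1982HodgeCycles, I §3 Prop. 3.4, 3.6] [cite: HoffmanKunze1971LinearAlgebra, §3.1 Thm. 2, §6.7] -/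
theorem UnitaryConstantRank.exists_fin_span_raise (k : ℕ) :
    ∀ {V : Type u} [AddCommGroup V] [Module ℂ V] [FiniteDimensional ℂ V] {𝔊 : Submodule ℂ (Module.End ℂ V)},
    (∀ Y ∈ 𝔊, ∀ Z ∈ 𝔊, Y * Z - Z * Y ∈ 𝔊) →
    (∀ U : Submodule ℂ V, (∀ A ∈ 𝔊, ∀ u ∈ U, A u ∈ U) → U = ⊥ ∨ U = ⊤) →
    ∀ {Θ : Module.End ℂ V}, Θ ∈ 𝔊 → Θ * Θ = 1 →
    ∀ {P Q : Submodule ℂ V}, (∀ x, x ∈ P ↔ Θ x = x) → (∀ x, x ∈ Q ↔ Θ x = -x) →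
    ∀ {r : ℕ}, 0 < r → Module.finrank ℂ P = r → Module.finrank ℂ Q = k * r →
    ∀ {s : V → V → ℂ}, (∀ x y z, s (x + y) z = s x z + s y z) → (∀ x y, s y x = starRingEnd ℂ (s x y)) →
    (∀ p ∈ P, ∀ q ∈ Q, s p q = 0) → (∀ p ∈ P, s p p = 0 → p = 0) → (∀ q ∈ Q, s q q = 0 → q = 0) →
    (∀ X ∈ 𝔊, ∃ Y ∈ 𝔊, ∀ x y, s (X x) y = s x (Y y)) →
    (∀ Y ∈ 𝔊, Θ * Y = Y → Y * Θ = -Y → Y ≠ 0 → Module.finrank ℂ (LinearMap.range Y) = r) →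
    ∃ F : Fin k → Module.End ℂ V, (∀ i, F i ∈ 𝔊 ∧ Θ * F i = F i ∧ F i * Θ = -(F i)) ∧
      ∀ Y ∈ 𝔊, Θ * Y = Y → Y * Θ = -Y → Y ∈ Submodule.span ℂ (Set.range F) := by
  induction k with
  | zero =>
    intro V _ _ _ 𝔊 hbr hirr Θ hΘ hΘΘ P Q hP hQ r hr hPr hQr s hadd hsymm hPQ hdefP hdefQ hadj hS
    have hΘΘv : ∀ v, Θ (Θ v) = v := fun v => by rw [← Module.End.mul_apply, hΘΘ, Module.End.one_apply]
    have hQbot : Q = ⊥ := Submodule.finrank_eq_zero.1 (by rw [hQr, zero_mul])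
    refine ⟨fun i => i.elim0, fun i => i.elim0, fun Y hY hΘY hYΘ => ?_⟩
    have hY0 : Y = 0 := by
      refine LinearMap.ext fun w => ?_
      have hp : Θ ((2 : ℂ)⁻¹ • (w + Θ w)) = (2 : ℂ)⁻¹ • (w + Θ w) := by rw [map_smul, map_add, hΘΘv, add_comm]
      have hq : (2 : ℂ)⁻¹ • (w - Θ w) ∈ Q := (hQ _).2 (by rw [map_smul, map_sub, hΘΘv, ← smul_neg, neg_sub])
      rw [hQbot, Submodule.mem_bot] at hq
      have hw : w = (2 : ℂ)⁻¹ • (w + Θ w) + (2 : ℂ)⁻¹ • (w - Θ w) := by module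
      have hkill : Y ((2 : ℂ)⁻¹ • (w + Θ w)) = 0 := by
        have h : Y ((2 : ℂ)⁻¹ • (w + Θ w)) = -(Y ((2 : ℂ)⁻¹ • (w + Θ w))) := by
          conv_lhs => rw [← hp, ← Module.End.mul_apply, hYΘ, LinearMap.neg_apply]
        have h2 : (2 : ℂ) • Y ((2 : ℂ)⁻¹ • (w + Θ w)) = 0 := by rw [two_smul]; nth_rewrite 2 [h]; rw [add_neg_cancel]
        exact (smul_eq_zero.1 h2).resolve_left two_ne_zero
      rw [hw, map_add, hkill, hq, map_zero, add_zero, LinearMap.zero_apply]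
    rw [hY0]
    exact Submodule.zero_mem _
  | succ k ih =>
    intro V _ _ _ 𝔊 hbr hirr Θ hΘ hΘΘ P Q hP hQ r hr hPr hQr s hadd hsymm hPQ hdefP hdefQ hadj hS
    classical
    have hΘΘv : ∀ v, Θ (Θ v) = v := fun v => by rw [← Module.End.mul_apply, hΘΘ, Module.End.one_apply]
    have hraiseval : ∀ Z : Module.End ℂ V, Θ * Z = Z → ∀ w, Z w ∈ P := fun Z hΘZ w =>
      (hP _).2 (by rw [← Module.End.mul_apply, hΘZ])
    have hraiseP : ∀ Z : Module.End ℂ V, Z * Θ = -Z → ∀ p, Θ p = p → Z p = 0 := fun Z hZΘ p hp => by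
      have h : Z p = -(Z p) := by
        conv_lhs => rw [← hp, ← Module.End.mul_apply, hZΘ, LinearMap.neg_apply]
      have h2 : (2 : ℂ) • Z p = 0 := by rw [two_smul]; nth_rewrite 2 [h]; rw [add_neg_cancel]
      exact (smul_eq_zero.1 h2).resolve_left two_ne_zero
    have hsU : ∀ U : Submodule ℂ V, ∀ x y z : U, s ((x + y : U) : V) z = s (x : V) z + s (y : V) z :=
      fun U x y z => by simp only [Submodule.coe_add, hadd]
    -- a non-zero raising operator, if any
    by_cases hex : ∃ X ∈ 𝔊, Θ * X = X ∧ X * Θ = -X ∧ X ≠ 0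
    swap
    · push Not at hex
      refine ⟨fun _ => 0, fun _ => ⟨Submodule.zero_mem _, mul_zero Θ, by rw [zero_mul, neg_zero]⟩,
        fun Y hY hΘY hYΘ => ?_⟩
      rw [hex Y hY hΘY hYΘ]
      exact Submodule.zero_mem _
    obtain ⟨X, hX, hΘX, hXΘ, hX0⟩ := hex
    have hrX : Module.finrank ℂ (LinearMap.range X) = r := hS X hX hΘX hXΘ hX0
    have hrangeX : LinearMap.range X = P :=
      Submodule.eq_of_le_of_finrank_eq (by rintro _ ⟨w, rfl⟩; exact hraiseval X hΘX w) (by rw [hrX, hPr])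
    -- the Levi pair of `X`
    obtain ⟨ι, Um, Up, PU, QU, Lm, ιm, Pm, Qm, Lp, ιp, Pp, Qp, hιmem, hιι, hιΘ, -, hUm, hUp, -, -,
      hPM, hQM, hPU, hQU, -, -, hQUQ, hfinQM, hfinPU, hfinQU, hLm, -,
      hιmapply, -, -, hbrLm, hirrLm, hιmmem, hιmιm, hPm, hQm, hfinPm, hfinQm, hPmQm, hdefPm, hdefQm, hadjLm,
      -, -, -, -, -, -, -, -, -, -, -, -, -, -, -, hsplit⟩ :=
      UnitaryLeviSetup.exists_levi_pair hbr hirr hΘ hΘΘ hP hQ hadd hsymm hPQ hdefP hdefQ hadj hX hΘX hXΘ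
    rw [hrX] at hfinQM hfinPU hfinQU hfinPm hfinQm hsplit
    rw [hPr] at hfinPU hsplit
    have hkr : (k + 1) * r = k * r + r := by ring
    have hcm : ∀ Z : Module.End ℂ V, Z * ι = ι * Z → ∀ x ∈ Um, Z x ∈ Um := fun Z hZ x hx =>
      (hUm _).2 (by rw [← Module.End.mul_apply, ← hZ, Module.End.mul_apply, (hUm x).1 hx, map_neg])
    have hPUbot : PU = ⊥ := Submodule.finrank_eq_zero.1 (by omega)
    have hιP : ∀ p, Θ p = p → ι p = -p := fun p hp => by
      have h : p ∈ LinearMap.range X := by rw [hrangeX]; exact (hP p).2 hp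
      exact ((hPM p).1 h).1
    have hXUm : ∀ u ∈ Um, X u = 0 := fun u hu => by
      have hιu := (hUm u).1 hu
      have hp : Θ ((2 : ℂ)⁻¹ • (u + Θ u)) = (2 : ℂ)⁻¹ • (u + Θ u) := by rw [map_smul, map_add, hΘΘv, add_comm]
      have hq : Θ ((2 : ℂ)⁻¹ • (u - Θ u)) = -((2 : ℂ)⁻¹ • (u - Θ u)) := by
        rw [map_smul, map_sub, hΘΘv, ← smul_neg, neg_sub]
      have hιq : ι ((2 : ℂ)⁻¹ • (u - Θ u)) = -((2 : ℂ)⁻¹ • (u - Θ u)) := by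
        rw [map_smul, map_sub, ← Module.End.mul_apply, hιΘ, Module.End.mul_apply, hιu, map_neg, neg_sub_neg, ← smul_neg,
          neg_sub]
      have hqmem := (hQM _).2 ⟨hιq, hq⟩
      have hu' : u = (2 : ℂ)⁻¹ • (u + Θ u) + (2 : ℂ)⁻¹ • (u - Θ u) := by module
      rw [hu', map_add, hraiseP X hXΘ _ hp, zero_add]
      exact LinearMap.mem_ker.1 (Submodule.mem_inf.1 hqmem).2
    -- decomposition `w = d + u`, `d ∈ Q ∩ U⁺`, `u ∈ U⁻`
    have hdec : ∀ w, ∃ d ∈ QU, ∃ u ∈ Um, w = d + u := by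
      intro w
      have hιιv : ∀ v, ι (ι v) = v := fun v => by rw [← Module.End.mul_apply, hιι, Module.End.one_apply]
      set a := (2 : ℂ)⁻¹ • (w + ι w) with ha
      set b := (2 : ℂ)⁻¹ • (w - ι w) with hb
      have hιa : ι a = a := by rw [ha, map_smul, map_add, hιιv, add_comm]
      have hιb : ι b = -b := by rw [hb, map_smul, map_sub, hιιv, ← smul_neg, neg_sub]
      set a₁ := (2 : ℂ)⁻¹ • (a + Θ a) with ha₁
      set a₂ := (2 : ℂ)⁻¹ • (a - Θ a) with ha₂
      have hΘι : ∀ v, Θ (ι v) = ι (Θ v) := fun v => by rw [← Module.End.mul_apply, ← hιΘ, Module.End.mul_apply]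
      have ha₁P : a₁ ∈ PU := (hPU _).2 ⟨by rw [ha₁, map_smul, map_add, ← hΘι, hιa], by
        rw [ha₁, map_smul, map_add, hΘΘv, add_comm]⟩
      have ha₂Q : a₂ ∈ QU := (hQU _).2 ⟨by rw [ha₂, map_smul, map_sub, ← hΘι, hιa], by
        rw [ha₂, map_smul, map_sub, hΘΘv, ← smul_neg, neg_sub]⟩
      rw [hPUbot, Submodule.mem_bot] at ha₁P
      refine ⟨a₂, ha₂Q, b, (hUm b).2 hιb, ?_⟩
      have h1 : w = a + b := by rw [ha, hb]; module
      have h2 : a = a₁ + a₂ := by rw [ha₁, ha₂]; module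
      rw [h1, h2, ha₁P, zero_add]
    have hQUne : QU ≠ ⊥ := fun h => by rw [h, finrank_bot] at hfinQU; omega
    have hXinj : ∀ d ∈ QU, X d = 0 → d = 0 := fun d hd hXd => by
      have h1 := ((hQU d).1 hd).1
      have h2 := ((hQM d).1 (Submodule.mem_inf.2 ⟨hQUQ hd, LinearMap.mem_ker.2 hXd⟩)).1
      rw [h1] at h2
      have h3 : (2 : ℂ) • d = 0 := by rw [two_smul]; nth_rewrite 2 [h2]; rw [add_neg_cancel]
      exact (smul_eq_zero.1 h3).resolve_left two_ne_zero
    -- constant rank `r` in `L⁻`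
    have hSm : ∀ A ∈ Lm, ιm * A = A → A * ιm = -A → A ≠ 0 → Module.finrank ℂ (LinearMap.range A) = r := by
      intro A hA hιA hAι hA0
      obtain ⟨XA, hXA, hΘXA, hXAΘ, hXAc, hXAv⟩ :=
        UnitaryLeviSetup.exists_lift_eq hbr hΘ hΘΘ hιΘ hLm hιmapply A hA hιA hAι
      obtain ⟨-, -, -, hrk⟩ := UnitaryLeviSetup.restrict_mem hcm hLm hιmapply XA hXA hΘXA hXAΘ hXAc
      have hres : XA.restrict (hcm XA hXAc) = A := LinearMap.ext fun v => Subtype.ext (by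
        rw [LinearMap.coe_restrict_apply, hXAv])
      rw [hres] at hrk
      have hXA0 : XA ≠ 0 := fun h => hA0 (by
        refine LinearMap.ext fun v => Subtype.ext ?_
        rw [← hXAv, h, LinearMap.zero_apply, LinearMap.zero_apply, Submodule.coe_zero])
      have hrXA := hS XA hXA hΘXA hXAΘ hXA0
      obtain ⟨hs', hi, -, -, -⟩ := hsplit XA hΘXA hXAΘ hXAc
      omega
    -- the induction hypothesis for `L⁻` (type `(r | kr)`)
    obtain ⟨F', hF', hspan'⟩ := ih hbrLm hirrLm hιmmem hιmιm hPm hQm hr hfinPm (by omega) (hsU Um)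
      (fun x y => hsymm x y) hPmQm hdefPm hdefQm hadjLm hSm
    -- lifts of the spanning family
    have hlift : ∀ i, ∃ Z ∈ 𝔊, Θ * Z = Z ∧ Z * Θ = -Z ∧ Z * ι = ι * Z ∧ ∀ v : Um, Z v = ((F' i v : Um) : V) :=
      fun i => UnitaryLeviSetup.exists_lift_eq hbr hΘ hΘΘ hιΘ hLm hιmapply (F' i) (hF' i).1 (hF' i).2.1 (hF' i).2.2
    choose Z hZ hΘZ hZΘ hZc hZv using hlift
    -- a raising operator commuting with `ι` kills `U⁺` (it maps `U⁺` into `P ∩ U⁺ = 0`)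
    have hkillUp : ∀ G : Module.End ℂ V, Θ * G = G → G * ι = ι * G → ∀ v, ι v = v → G v = 0 := by
      intro G hΘG hGc v hv
      have hmem : G v ∈ PU := (hPU _).2 ⟨by rw [← Module.End.mul_apply, ← hGc, Module.End.mul_apply, hv],
        by rw [← Module.End.mul_apply, hΘG]⟩
      rwa [hPUbot, Submodule.mem_bot] at hmem
    refine ⟨Fin.cons X Z, fun i => ?_, fun Y hY hΘY hYΘ => ?_⟩
    · refine Fin.cases ?_ (fun j => ?_) i
      · simpa only [Fin.cons_zero] using (⟨hX, hΘX, hXΘ⟩ : X ∈ 𝔊 ∧ Θ * X = X ∧ X * Θ = -X)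
      · simpa only [Fin.cons_succ] using (⟨hZ j, hΘZ j, hZΘ j⟩ : Z j ∈ 𝔊 ∧ Θ * Z j = Z j ∧ Z j * Θ = -(Z j))
    -- the splitting `Y = ½(Y − ιYι) + ½(Y + ιYι)` inside `𝔊`
    have hN : ι * Y - Y * ι ∈ 𝔊 := hbr ι hιmem Y hY
    have hM : ι * (ι * Y - Y * ι) - (ι * Y - Y * ι) * ι ∈ 𝔊 := hbr ι hιmem _ hN
    have hMeq : ι * (ι * Y - Y * ι) - (ι * Y - Y * ι) * ι = (Y - ι * Y * ι) + (Y - ι * Y * ι) := by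
      rw [mul_sub, sub_mul, ← mul_assoc ι ι Y, hιι, one_mul, mul_assoc Y ι ι, hιι, mul_one, ← mul_assoc ι Y ι]
      abel
    have hDmem : Y - ι * Y * ι ∈ 𝔊 := by
      have h := Submodule.smul_mem 𝔊 ((2 : ℂ)⁻¹) hM
      rw [hMeq, ← two_smul ℂ, smul_smul, inv_mul_cancel₀ (two_ne_zero (α := ℂ)), one_smul] at h
      exact h
    obtain ⟨Y₁, hY₁def⟩ : ∃ Y₁ : Module.End ℂ V, Y₁ = (2 : ℂ)⁻¹ • (Y - ι * Y * ι) := ⟨_, rfl⟩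
    obtain ⟨Y₂, hY₂def⟩ : ∃ Y₂ : Module.End ℂ V, Y₂ = (2 : ℂ)⁻¹ • (Y + ι * Y * ι) := ⟨_, rfl⟩
    have hYsum : Y = Y₁ + Y₂ := by rw [hY₁def, hY₂def]; module
    have hY₁mem : Y₁ ∈ 𝔊 := hY₁def ▸ Submodule.smul_mem _ _ hDmem
    have hY₂mem : Y₂ ∈ 𝔊 := by
      have h : Y₂ = Y - Y₁ := by rw [hYsum, add_sub_cancel_left]
      rw [h]
      exact Submodule.sub_mem _ hY hY₁mem
    have hΘιYι : Θ * (ι * Y * ι) = ι * Y * ι := by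
      rw [← mul_assoc, ← mul_assoc, ← hιΘ, mul_assoc ι Θ Y, hΘY]
    have hιYιΘ : ι * Y * ι * Θ = -(ι * Y * ι) := by
      rw [mul_assoc, hιΘ, ← mul_assoc, mul_assoc ι Y Θ, hYΘ, mul_neg, neg_mul]
    have hΘY₁ : Θ * Y₁ = Y₁ := by rw [hY₁def, mul_smul_comm, mul_sub, hΘY, hΘιYι]
    have hY₁Θ : Y₁ * Θ = -Y₁ := by rw [hY₁def, smul_mul_assoc, sub_mul, hYΘ, hιYιΘ, ← smul_neg, neg_sub_neg, neg_sub]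
    have hΘY₂ : Θ * Y₂ = Y₂ := by rw [hY₂def, mul_smul_comm, mul_add, hΘY, hΘιYι]
    have hY₂Θ : Y₂ * Θ = -Y₂ := by rw [hY₂def, smul_mul_assoc, add_mul, hYΘ, hιYιΘ, ← smul_neg, neg_add]
    have hY₂c : Y₂ * ι = ι * Y₂ := by
      rw [hY₂def, smul_mul_assoc, mul_smul_comm, add_mul, mul_add, mul_assoc (ι * Y) ι ι, hιι, mul_one,
        ← mul_assoc ι (ι * Y) ι, ← mul_assoc ι ι Y, hιι, one_mul, add_comm]
    -- pointwise behaviour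
    have hιY : ∀ w, ι (Y w) = -(Y w) := fun w => hιP _ (by rw [← Module.End.mul_apply, hΘY])
    have hY₁Um : ∀ u ∈ Um, Y₁ u = 0 := fun u hu => by
      rw [hY₁def, LinearMap.smul_apply, LinearMap.sub_apply, Module.End.mul_apply, Module.End.mul_apply,
        (hUm u).1 hu, map_neg, map_neg, hιY, neg_neg, sub_self, smul_zero]
    have hY₁Up : ∀ v, ι v = v → Y₁ v = Y v := fun v hv => by
      rw [hY₁def, LinearMap.smul_apply, LinearMap.sub_apply, Module.End.mul_apply, Module.End.mul_apply, hv, hιY,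
        sub_neg_eq_add, ← two_smul ℂ, smul_smul, inv_mul_cancel₀ (two_ne_zero (α := ℂ)), one_smul]
    have hY₂Um : ∀ u ∈ Um, Y₂ u = Y u := fun u hu => by
      have h : Y₂ u = Y u - Y₁ u := by rw [hYsum, LinearMap.add_apply, add_sub_cancel_left]
      rw [h, hY₁Um u hu, sub_zero]
    -- `Y₁` is a multiple of `X`
    have hY₁span : ∃ c₀ : ℂ, Y₁ = c₀ • X := by
      obtain ⟨c, hc⟩ := UnitaryRaisingSpace.exists_finrank_range_sub_smul_lt X Y₁ QU hQUne
        (fun w => by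
          obtain ⟨d, hd, u, hu, hw⟩ := hdec w
          exact ⟨d, hd, by rw [hw, map_add, hXUm u hu, add_zero], by rw [hw, map_add, hY₁Um u hu, add_zero]⟩)
        hXinj
        (fun d hd => by
          obtain ⟨w', hw'⟩ : Y₁ d ∈ LinearMap.range X := by rw [hrangeX]; exact hraiseval Y₁ hΘY₁ d
          obtain ⟨d', hd', u', hu', hw'dec⟩ := hdec w'
          exact ⟨d', hd', by rw [← hw', hw'dec, map_add, hXUm u' hu', add_zero]⟩)
      rw [hfinQU] at hc
      refine ⟨c, ?_⟩
      have hmem : Y₁ - c • X ∈ 𝔊 := Submodule.sub_mem _ hY₁mem (Submodule.smul_mem _ _ hX)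
      have h0 : Y₁ - c • X = 0 := by
        by_contra hne
        have := hS _ hmem (by rw [mul_sub, mul_smul_comm, hΘY₁, hΘX])
          (by rw [sub_mul, smul_mul_assoc, hY₁Θ, hXΘ, smul_neg]; abel) hne
        omega
      rwa [sub_eq_zero] at h0
    obtain ⟨c₀, hc₀⟩ := hY₁span
    -- `Y₂` is a combination of the lifts
    obtain ⟨hA₂mem, hιA₂, hA₂ι, -⟩ := UnitaryLeviSetup.restrict_mem hcm hLm hιmapply Y₂ hY₂mem hΘY₂ hY₂Θ hY₂c
    obtain ⟨c, hc⟩ := (Submodule.mem_span_range_iff_exists_fun ℂ).1 (hspan' _ hA₂mem hιA₂ hA₂ι)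
    have hY₂eq : Y₂ = ∑ i, c i • Z i := by
      refine LinearMap.ext fun w => ?_
      obtain ⟨d, hd, u, hu, hw⟩ := hdec w
      have hιd : ι d = d := ((hQU d).1 hd).1
      have hsumu : (∑ i, c i • Z i) u = Y₂ u := by
        have h := congrArg (fun T : Module.End ℂ Um => ((T ⟨u, hu⟩ : Um) : V)) hc
        simp only [LinearMap.sum_apply, LinearMap.smul_apply, Submodule.coe_sum, Submodule.coe_smul,
          LinearMap.coe_restrict_apply, ← hZv] at h
        rw [LinearMap.sum_apply]
        simpa only [LinearMap.smul_apply] using h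
      have hsumd : (∑ i, c i • Z i) d = 0 := by
        rw [LinearMap.sum_apply]
        exact Finset.sum_eq_zero fun i _ => by
          rw [LinearMap.smul_apply, hkillUp (Z i) (hΘZ i) (hZc i) d hιd, smul_zero]
      rw [hw, map_add, map_add, hsumu, hsumd, hkillUp Y₂ hΘY₂ hY₂c d hιd]
    -- assemble
    rw [Submodule.mem_span_range_iff_exists_fun]
    refine ⟨Fin.cons c₀ c, ?_⟩
    rw [Fin.sum_univ_succ, Fin.cons_zero, Fin.cons_zero]
    simp only [Fin.cons_succ]
    rw [← hY₂eq, ← hc₀, hYsum]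

/-! ### §2 Irreducible, raising ranks in `{0, r}`, `dim P = kr`, `0 < dim Q ≠ r`: more than `k` raising operators -/

/-- Subspaces `R₀, …, R_{k−1}` of dimension `≤ r` span a subspace of dimension `≤ kr`, with equality only if they
are independent: then `Σ xᵢ = 0`, `xᵢ ∈ Rᵢ` forces every `xᵢ = 0`. [cite: HoffmanKunze1971LinearAlgebra, §6.7, §3.1 Thm. 2] -/
theorem UnitaryRaisingSpace.sum_eq_zero_of_finrank_iSup [FiniteDimensional ℂ W] {r : ℕ} (k : ℕ) :
    ∀ (R : Fin k → Submodule ℂ W), (∀ i, Module.finrank ℂ (R i) ≤ r) →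
      Module.finrank ℂ (⨆ i, R i : Submodule ℂ W) ≤ k * r ∧
        (k * r ≤ Module.finrank ℂ (⨆ i, R i : Submodule ℂ W) →
          ∀ x : Fin k → W, (∀ i, x i ∈ R i) → ∑ i, x i = 0 → ∀ i, x i = 0) := by
  induction k with
  | zero =>
    intro R hR
    refine ⟨?_, fun _ x _ _ i => i.elim0⟩
    rw [show (⨆ i, R i : Submodule ℂ W) = ⊥ from iSup_of_empty _, finrank_bot, zero_mul]
  | succ k ih =>
    intro R hR
    obtain ⟨hSle, hSinj⟩ := ih (fun j => R (Fin.castSucc j)) (fun j => hR _)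
    have hsup : (⨆ i, R i : Submodule ℂ W) = (⨆ j : Fin k, R (Fin.castSucc j)) ⊔ R (Fin.last k) := by
      refine le_antisymm (iSup_le fun i => ?_) (sup_le (iSup_le fun j => le_iSup R _) (le_iSup R _))
      induction i using Fin.lastCases with
      | last => exact le_sup_right
      | cast j => exact (le_iSup (fun j => R (Fin.castSucc j)) j).trans le_sup_left
    have hkr : (k + 1) * r = k * r + r := by ring
    have hT := hR (Fin.last k)
    have hST := Submodule.finrank_add_le_finrank_add_finrank (s := ⨆ j : Fin k, R (Fin.castSucc j))
      (t := R (Fin.last k))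
    rw [hsup]
    refine ⟨by omega, fun hge x hx hsum => ?_⟩
    have hdim := Submodule.finrank_sup_add_finrank_inf_eq (⨆ j : Fin k, R (Fin.castSucc j)) (R (Fin.last k))
    have hinf : (⨆ j : Fin k, R (Fin.castSucc j)) ⊓ R (Fin.last k) = ⊥ := Submodule.finrank_eq_zero.1 (by omega)
    have hxS : ∑ j : Fin k, x (Fin.castSucc j) ∈ ⨆ j : Fin k, R (Fin.castSucc j) :=
      Submodule.sum_mem _ fun j _ => (le_iSup (fun j => R (Fin.castSucc j)) j) (hx _)
    rw [Fin.sum_univ_castSucc] at hsum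
    have hlast : x (Fin.last k) = 0 := by
      have hmem : x (Fin.last k) ∈ (⨆ j : Fin k, R (Fin.castSucc j)) ⊓ R (Fin.last k) :=
        Submodule.mem_inf.2 ⟨by rw [eq_neg_of_add_eq_zero_right hsum]; exact Submodule.neg_mem _ hxS, hx _⟩
      rwa [hinf, Submodule.mem_bot] at hmem
    rw [hlast, add_zero] at hsum
    have hcast := hSinj (by omega) (fun j => x (Fin.castSucc j)) (fun j => hx _) hsum
    intro i
    induction i using Fin.lastCases with
    | last => exact hlast
    | cast j => exact hcast j

/-- **`k` raising operators never span** (irreducible unitary algebra, raising ranks in `{0, r}`, `dim P = kr > 0`,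
`0 < dim Q ≠ r`). If every raising operator of `𝔊` were a combination of raising `F₀, …, F_{k−1} ∈ 𝔊`, then the
values of raising operators — which span `P` (`UnitaryThetaCore.mem_span_raise_apply`) — would lie in `Σ Fᵢ(W)`, so
the images `Fᵢ(W)` have dimension `r` and are independent; the joint kernel on `Q` of all raising operators is zero
(`UnitaryThetaCore.eq_zero_of_forall_raise_apply_eq_zero`), so `Σ Fᵢ` is injective on `Q` and has rank
`dim Q ∉ {0, r}`. [cite: Gordon1997, §6 (proof of Thm. 6.3.3, p. 19)] [cite: Ribet1983, Thm. 3]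
[cite: GoodmanWallachGTM255, §4.1.1] [cite: HoffmanKunze1971LinearAlgebra, §3.1 Thm. 2, §6.7] -/
theorem UnitaryConstantRank.exists_raise_not_mem_span_fin [FiniteDimensional ℂ W] {𝔊 : Submodule ℂ (Module.End ℂ W)}
    (hbr : ∀ Y ∈ 𝔊, ∀ Z ∈ 𝔊, Y * Z - Z * Y ∈ 𝔊)
    (hirr : ∀ U : Submodule ℂ W, (∀ A ∈ 𝔊, ∀ u ∈ U, A u ∈ U) → U = ⊥ ∨ U = ⊤)
    {Θ : Module.End ℂ W} (hΘ : Θ ∈ 𝔊) (hΘΘ : Θ * Θ = 1)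
    {P Q : Submodule ℂ W} (hP : ∀ x, x ∈ P ↔ Θ x = x) (hQ : ∀ x, x ∈ Q ↔ Θ x = -x)
    {r k : ℕ} (hr : 0 < r) (hk : 0 < k) (hPr : Module.finrank ℂ P = k * r) (hQ0 : 0 < Module.finrank ℂ Q)
    (hQr : Module.finrank ℂ Q ≠ r)
    (hS : ∀ Y ∈ 𝔊, Θ * Y = Y → Y * Θ = -Y →
      Module.finrank ℂ (LinearMap.range Y) = 0 ∨ Module.finrank ℂ (LinearMap.range Y) = r)
    {F : Fin k → Module.End ℂ W} (hF : ∀ i, F i ∈ 𝔊 ∧ Θ * F i = F i ∧ F i * Θ = -(F i)) :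
    ∃ Y ∈ 𝔊, Θ * Y = Y ∧ Y * Θ = -Y ∧ Y ∉ Submodule.span ℂ (Set.range F) := by
  classical
  have hΘΘv : ∀ v, Θ (Θ v) = v := fun v => by rw [← Module.End.mul_apply, hΘΘ, Module.End.one_apply]
  have hraiseP : ∀ Z : Module.End ℂ W, Z * Θ = -Z → ∀ p ∈ P, Z p = 0 := fun Z hZΘ p hp => by
    have h : Z p = -(Z p) := by
      conv_lhs => rw [← (hP p).1 hp]
      rw [← Module.End.mul_apply, hZΘ, LinearMap.neg_apply]
    have h2 : (2 : ℂ) • Z p = 0 := by rw [two_smul]; nth_rewrite 2 [h]; rw [add_neg_cancel]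
    exact (smul_eq_zero.1 h2).resolve_left two_ne_zero
  by_contra hall
  push Not at hall
  have hcomb : ∀ Y ∈ 𝔊, Θ * Y = Y → Y * Θ = -Y → ∃ c : Fin k → ℂ, Y = ∑ i, c i • F i := by
    intro Y hY hΘY hYΘ
    obtain ⟨c, hc⟩ := (Submodule.mem_span_range_iff_exists_fun ℂ).1 (hall Y hY hΘY hYΘ)
    exact ⟨c, hc.symm⟩
  -- (i) `P ≤ Σ Fᵢ(W)`: the images have dimension `r` and are independent
  obtain ⟨⟨q₀, hq₀⟩, hq₀0⟩ := Module.finrank_pos_iff_exists_ne_zero.1 hQ0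
  have hQ0' : ∃ q : W, q ≠ 0 ∧ Θ q = -q := ⟨q₀, fun h => hq₀0 (Subtype.ext h), (hQ q₀).1 hq₀⟩
  have hPpos : 0 < Module.finrank ℂ P := by rw [hPr]; exact Nat.mul_pos hk hr
  obtain ⟨⟨p₀, hp₀⟩, hp₀0⟩ := Module.finrank_pos_iff_exists_ne_zero.1 hPpos
  have hP0' : ∃ p : W, p ≠ 0 ∧ Θ p = p := ⟨p₀, fun h => hp₀0 (Subtype.ext h), (hP p₀).1 hp₀⟩
  have hPle : P ≤ ⨆ i, LinearMap.range (F i) := by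
    intro y hy
    have h := UnitaryThetaCore.mem_span_raise_apply hbr hirr hΘ hΘΘ hQ0' ((hP y).1 hy)
    refine (Submodule.span_le.2 ?_) h
    rintro _ ⟨B, hB, hΘB, hBΘ, w, rfl⟩
    obtain ⟨c, hBc⟩ := hcomb B hB hΘB hBΘ
    rw [hBc, LinearMap.sum_apply]
    exact Submodule.sum_mem _ fun i _ => by
      rw [LinearMap.smul_apply]
      exact Submodule.smul_mem _ _ ((le_iSup (fun i => LinearMap.range (F i)) i) (LinearMap.mem_range_self _ w))
  have hle : ∀ i, Module.finrank ℂ (LinearMap.range (F i)) ≤ r := fun i => by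
    rcases hS (F i) (hF i).1 (hF i).2.1 (hF i).2.2 with h | h <;> omega
  obtain ⟨-, hinj⟩ := UnitaryRaisingSpace.sum_eq_zero_of_finrank_iSup k (fun i => LinearMap.range (F i)) hle
  have hinj' := hinj (by rw [← hPr]; exact Submodule.finrank_mono hPle)
  -- (ii) `Σ Fᵢ` is injective on `Q`
  obtain ⟨T, hTdef⟩ : ∃ T : Module.End ℂ W, T = ∑ i, F i := ⟨_, rfl⟩
  have hT : T ∈ 𝔊 := hTdef ▸ Submodule.sum_mem _ fun i _ => (hF i).1
  have hΘT : Θ * T = T := by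
    rw [hTdef, Finset.mul_sum]
    exact Finset.sum_congr rfl fun i _ => (hF i).2.1
  have hTΘ : T * Θ = -T := by
    rw [hTdef, Finset.sum_mul, ← Finset.sum_neg_distrib]
    exact Finset.sum_congr rfl fun i _ => (hF i).2.2
  have hinjQ : ∀ q, Θ q = -q → T q = 0 → q = 0 := by
    intro q hq hTq
    rw [hTdef, LinearMap.sum_apply] at hTq
    have hzero := hinj' (fun i => F i q) (fun i => LinearMap.mem_range_self _ q) hTq
    refine UnitaryThetaCore.eq_zero_of_forall_raise_apply_eq_zero hbr hirr hΘ hΘΘ hP0' hq fun B hB hΘB hBΘ => ?_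
    obtain ⟨c, hBc⟩ := hcomb B hB hΘB hBΘ
    rw [hBc, LinearMap.sum_apply]
    exact Finset.sum_eq_zero fun i _ => by rw [LinearMap.smul_apply, hzero i, smul_zero]
  -- (iii) so its rank is `dim Q ∉ {0, r}`
  have hrange : LinearMap.range T = Q.map T := by
    refine le_antisymm ?_ LinearMap.map_le_range
    rintro _ ⟨w, rfl⟩
    have hq : (2 : ℂ)⁻¹ • (w - Θ w) ∈ Q := (hQ _).2 (by rw [map_smul, map_sub, hΘΘv, ← smul_neg, neg_sub])
    have hp : (2 : ℂ)⁻¹ • (w + Θ w) ∈ P := (hP _).2 (by rw [map_smul, map_add, hΘΘv, add_comm])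
    refine ⟨_, hq, ?_⟩
    have hw : (2 : ℂ)⁻¹ • (w + Θ w) + (2 : ℂ)⁻¹ • (w - Θ w) = w := by module
    conv_rhs => rw [← hw, map_add, hraiseP _ hTΘ _ hp, zero_add]
  have hker : LinearMap.ker (T.domRestrict Q) = ⊥ := by
    rw [LinearMap.ker_eq_bot']
    intro q hq
    exact Subtype.ext (hinjQ q ((hQ q).1 q.2) hq)
  have hrk := LinearMap.finrank_range_add_finrank_ker (T.domRestrict Q)
  rw [LinearMap.range_domRestrict, ← hrange, hker, finrank_bot, add_zero] at hrk
  rcases hS _ hT hΘT hTΘ with h | h <;> omega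

/-! ### §3 Transfer of a spanning family through a Levi pair -/

/-- **Transfer.** At a raising `B` with Levi pair `L⁺` (on `U⁺`), `L⁻` (on `U⁻`): if every raising operator of `𝔊`
commuting with `ι` that vanishes on `U⁺` vanishes on `U⁻`, then a family of `k` raising elements of `L⁺` spanning the
raising elements of `L⁺` yields such a family for `L⁻` (lift the family to `𝔊`, restrict to `U⁻`; for a raising
`A ∈ L⁻` lift it, expand its restriction to `U⁺`, and compare). [cite: GoodmanWallachGTM255, §4.1.1]
[cite: Deligne1982HodgeCycles, I §3 Prop. 3.4, 3.6] -/
theorem UnitaryLeviSetup.exists_fin_span_transfer [FiniteDimensional ℂ W] {𝔊 : Submodule ℂ (Module.End ℂ W)}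
    (hbr : ∀ Y ∈ 𝔊, ∀ Z ∈ 𝔊, Y * Z - Z * Y ∈ 𝔊) {Θ : Module.End ℂ W} (hΘ : Θ ∈ 𝔊) (hΘΘ : Θ * Θ = 1)
    {ι : Module.End ℂ W} {Up Um : Submodule ℂ W} {Lp : Submodule ℂ (Module.End ℂ Up)}
    {Lm : Submodule ℂ (Module.End ℂ Um)} {ιp : Module.End ℂ Up} {ιm : Module.End ℂ Um}
    (hιΘ : ι * Θ = Θ * ι) (hUm : ∀ x, x ∈ Um ↔ ι x = -x) (hUp : ∀ x, x ∈ Up ↔ ι x = x)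
    (hLp : ∀ A, A ∈ Lp ↔ ∃ Z ∈ 𝔊, Z * ι = ι * Z ∧ ∀ x : Up, ((A x : Up) : W) = Z x)
    (hLm : ∀ A, A ∈ Lm ↔ ∃ Z ∈ 𝔊, Z * ι = ι * Z ∧ ∀ x : Um, ((A x : Um) : W) = Z x)
    (hιpapply : ∀ x : Up, ((ιp x : Up) : W) = Θ x) (hιmapply : ∀ x : Um, ((ιm x : Um) : W) = Θ x)
    (hrule : ∀ X ∈ 𝔊, Θ * X = X → X * Θ = -X → X * ι = ι * X → (∀ v ∈ Up, X v = 0) → ∀ u ∈ Um, X u = 0)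
    {k : ℕ} {F : Fin k → Module.End ℂ Up} (hF : ∀ i, F i ∈ Lp ∧ ιp * F i = F i ∧ F i * ιp = -(F i))
    (hspan : ∀ A ∈ Lp, ιp * A = A → A * ιp = -A → A ∈ Submodule.span ℂ (Set.range F)) :
    ∃ G : Fin k → Module.End ℂ Um, (∀ i, G i ∈ Lm ∧ ιm * G i = G i ∧ G i * ιm = -(G i)) ∧
      ∀ A ∈ Lm, ιm * A = A → A * ιm = -A → A ∈ Submodule.span ℂ (Set.range G) := by
  classical
  have hcm : ∀ Z : Module.End ℂ W, Z * ι = ι * Z → ∀ x ∈ Um, Z x ∈ Um := fun Z hZ x hx =>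
    (hUm _).2 (by rw [← Module.End.mul_apply, ← hZ, Module.End.mul_apply, (hUm x).1 hx, map_neg])
  have hcp : ∀ Z : Module.End ℂ W, Z * ι = ι * Z → ∀ x ∈ Up, Z x ∈ Up := fun Z hZ x hx =>
    (hUp _).2 (by rw [← Module.End.mul_apply, ← hZ, Module.End.mul_apply, (hUp x).1 hx])
  have hlift : ∀ i, ∃ X ∈ 𝔊, Θ * X = X ∧ X * Θ = -X ∧ X * ι = ι * X ∧ ∀ v : Up, X v = ((F i v : Up) : W) :=
    fun i => UnitaryLeviSetup.exists_lift_eq hbr hΘ hΘΘ hιΘ hLp hιpapply (F i) (hF i).1 (hF i).2.1 (hF i).2.2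
  choose X hX hΘX hXΘ hXc hXv using hlift
  refine ⟨fun i => (X i).restrict (hcm (X i) (hXc i)), fun i => ?_, fun A hA hιA hAι => ?_⟩
  · obtain ⟨h1, h2, h3, -⟩ := UnitaryLeviSetup.restrict_mem hcm hLm hιmapply (X i) (hX i) (hΘX i) (hXΘ i) (hXc i)
    exact ⟨h1, h2, h3⟩
  obtain ⟨XA, hXA, hΘXA, hXAΘ, hXAc, hXAv⟩ := UnitaryLeviSetup.exists_lift_eq hbr hΘ hΘΘ hιΘ hLm hιmapply A hA hιA hAι
  obtain ⟨hApmem, hιAp, hApι, -⟩ := UnitaryLeviSetup.restrict_mem hcp hLp hιpapply XA hXA hΘXA hXAΘ hXAc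
  obtain ⟨c, hc⟩ := (Submodule.mem_span_range_iff_exists_fun ℂ).1 (hspan _ hApmem hιAp hApι)
  -- `D = XA − Σ cᵢ Xᵢ` vanishes on `U⁺`, hence on `U⁻`
  obtain ⟨S, hSdef⟩ : ∃ S : Module.End ℂ W, S = ∑ i, c i • X i := ⟨_, rfl⟩
  have hSmem : S ∈ 𝔊 := hSdef ▸ Submodule.sum_mem _ fun i _ => Submodule.smul_mem _ _ (hX i)
  have hΘS : Θ * S = S := by
    rw [hSdef, Finset.mul_sum]
    exact Finset.sum_congr rfl fun i _ => by rw [mul_smul_comm, hΘX i]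
  have hSΘ : S * Θ = -S := by
    rw [hSdef, Finset.sum_mul, ← Finset.sum_neg_distrib]
    exact Finset.sum_congr rfl fun i _ => by rw [smul_mul_assoc, hXΘ i, smul_neg]
  have hSc : S * ι = ι * S := by
    rw [hSdef, Finset.sum_mul, Finset.mul_sum]
    exact Finset.sum_congr rfl fun i _ => by rw [smul_mul_assoc, mul_smul_comm, hXc i]
  have hSapply : ∀ w, S w = ∑ i, c i • X i w := fun w => by
    rw [hSdef, LinearMap.sum_apply]
    exact Finset.sum_congr rfl fun i _ => by rw [LinearMap.smul_apply]
  have hDUp : ∀ v ∈ Up, (XA - S) v = 0 := fun v hv => by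
    have h := congrArg (fun T : Module.End ℂ Up => ((T ⟨v, hv⟩ : Up) : W)) hc
    simp only [LinearMap.sum_apply, LinearMap.smul_apply, Submodule.coe_sum, Submodule.coe_smul,
      LinearMap.coe_restrict_apply, ← hXv] at h
    rw [LinearMap.sub_apply, hSapply, h, sub_self]
  have hDUm := hrule (XA - S) (Submodule.sub_mem _ hXA hSmem) (by rw [mul_sub, hΘXA, hΘS])
    (by rw [sub_mul, hXAΘ, hSΘ, neg_sub_neg, neg_sub]) (by rw [sub_mul, mul_sub, hXAc, hSc]) hDUp
  rw [Submodule.mem_span_range_iff_exists_fun]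
  refine ⟨c, LinearMap.ext fun u => Subtype.ext ?_⟩
  have h0 := hDUm u u.2
  rw [LinearMap.sub_apply, sub_eq_zero, hXAv, hSapply] at h0
  rw [h0, LinearMap.sum_apply, Submodule.coe_sum]
  exact Finset.sum_congr rfl fun i _ => by
    rw [LinearMap.smul_apply, Submodule.coe_smul, LinearMap.coe_restrict_apply]

end HodgeStructure

end Literature.AlgebraicGeometry.Motives

end
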